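import Mathlib
import HarnessLib
import HarnessLib.Audit
import Summits.CriticalPhenomena.Statement

/-!
Route: PercFluxFromDensity

DORMANT since 2026-08-29T23:50:30Z (reconciler: no traction for 5 d (last activity statement-closed at 2026-08-24T22:59:05Z); parked, not closed — `ledger route dormant route-CriticalPhenomena-PercFluxFromDensity --off` to reactivate) — unstaffed, not closed; items shared with open routes are served there. `ledger route dormant <id> --off` reactivates.

# Route PercFluxFromDensity — density cannot outlive flux — Zhang's zero critical max-flow (a BGN
cutset theorem) plus a uniform supercritical bound flux ≥ g(θ) force θ(p_c)=0

X = FluxFromDensity ("density cannot outlive flux"; card zero-flux-last-order-parameter, item r2 in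
qualitative form): for every
density level t > 0 there are s > 0 and C such that at EVERY p > p_c(ℤ³) with θ(p) ≥ t and for every
n, the expected maximal number
MC_n of pairwise edge-disjoint open paths of the cube Λ_n = box 3 n = [−n,n]³ joining the face {x₀ =
−n} to the face {x₀ = n} is at least
s·n² − C·n. By max-flow/min-cut MC_n = min number of OPEN edges in an edge set meeting every such
path, and E_p[MC_n] is written as the
finite layer-cake sum Σ_{k<(2n+1)²} (1 − P_p(min-cut ≤ k)) (MC_n ≤ (2n+1)² always), so X is a
statement over bondPercolation, box,
openConnIn and theta only. Zhang 2000 / Rossignol–Théret 2018 Prop 3.9 give E_{p_c}[MC_n] = o(n²)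
(item CriticalZeroFlux, a
Barsky–Grimmett–Newman cutset argument resting on the tree's PROVED
BarskyGrimmettNewman1991_Z3_holds), the finite-volume flux is a
polynomial in p, and θ is monotone: hence X ⇒ θ(p_c) = 0. Conversely θ(p_c) = 0 ⇒ X (Grimmett1999
Thm (7.68) at the level-t entry
parameter p_t > p_c, plus right-continuity of θ), so X is an exact reformulation of the conjunct
that lives entirely on (p_c, 1].
Lean: `∀ t : ℝ, 0 < t → ∃ s C : ℝ, 0 < s ∧ ∀ p : unitInterval,
Literature.Probability.Percolation.criticalProb (Literature.Probability.LatticeModels.zdGraph 3) (0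
: Literature.Probability.LatticeModels.Site 3) < (p : ℝ) → t ≤
Literature.Probability.Percolation.theta (Literature.Probability.LatticeModels.zdGraph 3) (0 :
Literature.Probability.LatticeModels.Site 3) p → ∀ n : ℕ, s * (n : ℝ) ^ 2 - C * n ≤ ∑ k ∈
Finset.range ((2 * n + 1) ^ 2), (1 - (Literature.Probability.Percolation.bondPercolation
(Literature.Probability.LatticeModels.zdGraph 3) p).real {ω | ∃ F : Finset (Sym2
(Literature.Probability.LatticeModels.Site 3)), ((↑F : Set (Sym2
(Literature.Probability.LatticeModels.Site 3))) ∩ ω).ncard ≤ k ∧ ∀ x ∈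
Literature.Probability.LatticeModels.box 3 n, ∀ y ∈ Literature.Probability.LatticeModels.box 3 n, x
0 = -(n : ℤ) → y 0 = (n : ℤ) → ω \ ↑F ∉ Literature.Probability.Percolation.openConnIn
↑(Literature.Probability.LatticeModels.box 3 n) x y})`

## Assembly
By contradiction, t := θ(p_c) > 0. FluxFromDensity at level t gives s > 0, C with E_p[MC_n] ≥ s n² −
C n for all p > p_c (θ(p) ≥ θ(p_c) = t
by theta_mono_holds) and all n; CutEventContinuous makes n ↦ E_p[MC_n] a finite sum of continuous
functions of p, and p_c < 1
(criticalProb_zd_lt_one) lets p ↓ p_c along p_c + 1/(k+1): E_{p_c}[MC_n] ≥ s n² − C n for every n.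
CriticalZeroFlux with ε = s/2 gives
E_{p_c}[MC_n] ≤ s n²/2 for n ≥ n₀ — impossible for n > max(n₀, 2|C|/s). PROVED in the planner sketch
modulo the support item:
`assembly_of_support : CutEventContinuous → Assembly` (Sketch.lean rc 0, 0 sorry; uses only
theta_mono_holds, criticalProb_zd_lt_one).

Rationale: WHY THIS LINE. Max-flow/min-cut duality turns "no infinite cluster at criticality" into "an infinite
cluster must carry water": the flow constant
ν(p) = lim n⁻² E_p[MC_n] is the one natural order parameter of 3-D Bernoulli percolation whose
continuity at p_c is already a THEOREM
(Zhang2000; RossignolTheret2018 Thm 2.4 and Prop 3.9, whose proof is Grimmett1999 Thm (7.35) =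
Barsky–Grimmett–Newman used as a cutset,
arXiv:1707.08766 p.17), so θ(p_c) = 0 becomes a comparison of two monotone functions on the
supercritical interval, ν ≥ g(θ), where
uniqueness, sprinkling from (p+p_c)/2, Grimmett–Marstrand blocks (Grimmett1999 Thm (7.68): β(p) > 0
disjoint crossings) and the
Kesten1987 / Zhang / Cerf–Théret min-cut technology are all legal — at the declared price that
constants may depend on p only through θ(p)
(DuminilCopinSidoraviciusTassion2016 Prop 3 'uniform control', here in transport clothing). Imported
areas: first-passage-percolation flow
theory (laws of large numbers, continuity of G ↦ ν_G), LP duality (Menger: lower bounds on flux are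
certified by CUT inequalities, and cuts
compose by union where paths do not), supercritical static renormalisation. Versus the other routes
of the sub-problem: PercLowPointHalfSpace,
PercFiniteBoxLRO, PercOpenSupercrit, PercTwoPointDecay ask same-p criteria AT p_c and
PercAnnulusCrossing asks critical 3-D RSW; this line asks
nothing at p_c beyond Zhang's theorem, is the only route using flows/min-cuts, and the negatives
index (one SAW statement) is untouched.
Nearest print is CerfDembin2020 Lemma 2.1, which combines Zhang2000 with RossignolTheret2018 to send
the anchored isoperimetric profile to 0
as p ↓ p_c; the route's delta is to make the CONVERSE comparison the crux, in finite volume, and to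
formalise Zhang's theorem in the tree.

RANKED CRUXES. #2 CriticalZeroFlux (crux) — Zhang's zero critical flux in finite volume (Zhang2000;
RossignolTheret2018 Prop 3.9, Bernoulli capacities, cube): at p = p_c(ℤ³), for every ε > 0 and all
large n, Σ_{k<(2n+1)²} (1 − P_{p_c}(some edge set F with ≤ k open edges meets every open path of box
3 n from {x₀ = −n} to {x₀ = n})) ≤ ε n², i.e. E_{p_c}[MC_n] = o(n²). Proof to formalise (RT18 p.17):
the level-ℓ cut F_ℓ = vertical edges from height −n+ℓ−1 to −n+ℓ whose lower endpoint is joined to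
the bottom face by an open path inside the slab is a separating set for every configuration, so MC_n
≤ |F_ℓ| and E|F_ℓ| ≤ (2n+1)² · P_{p_c}(0 ↔ ∂B(ℓ−1) inside the half-space) → 0 as ℓ → ∞ by
BarskyGrimmettNewman1991_Z3_holds (PROVED in tree, HalfSpaceProofs.lean) and continuity from above.
Ranked FIRST by the plancard rule (the one unproved published fact the Assembly needs); it is also
the dossier fact 'the counterfactual critical cluster carries zero flux' wanted by cards
two-arm-foam-structure, sponge-fkg-fragile-giant, critical-cluster-threshold-one and the base rung
L0 of maxflow-budget-ladder. [difficulty: L] (why it might fail: A theorem on paper (RT18 Prop 3.9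
via Grimmett Thm 7.35); the risk is formal: BGN_Z3 speaks of θ of the INDUCED half-space graph, the
cut needs openConnIn-restricted paths of the full configuration (bridge: ConstrainedClusters.lean)
plus a layer-cake identity — L-size, not S.) [Zhang2000, RossignolTheret2018,
BarskyGrimmettNewman1991, Grimmett1999]
#3 FluxFromDensity (crux) — X itself (card r2, qualitative form): ∀ t > 0 ∃ s > 0, C: ∀ p > p_c(ℤ³)
with θ(p) ≥ t, ∀ n: E_p[MC_n] ≥ s n² − C n, with E_p[MC_n] the layer-cake sum of min-cut
probabilities of box 3 n between the faces x₀ = ∓n. EQUIVALENT to θ(p_c) = 0 given CriticalZeroFlux,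
Grimmett1999 Thm (7.68) and right-continuity of θ; its whole content is that the supercritical flux
is bounded below by a function of the DENSITY ALONE, uniformly as p ↓ p_c. [deps: CriticalZeroFlux]
[difficulty: open-problem] (why it might fail: Fails iff θ(p_c)>0 (flux→0 by Zhang+continuity while
θ≥θ*): conjunct-strength by design. The one lower bound on supercritical flux in print (Grimmett1999
Thm 7.68, β(p)>0) uses Grimmett–Marstrand blocks whose scale nothing ties to θ(p); DST rate such
uniform control 'of the same difficulty'.) [Grimmett1999, Zhang2000, RossignolTheret2018,
arXiv:1401.7130, CerfDembin2020, KozmaNitzan2024]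
#4 PowerFluxFromDensity (crux) — power-law form of X (card 'g(t) = c t^A'): ∃ A ∈ ℕ, c > 0, C: ∀ p >
p_c(ℤ³), ∀ n: E_p[MC_n] ≥ c n² θ(p)^A − C n. This is the shape a density-only renormalisation would
deliver (ν(p) ≥ c/L(p)² from a good block scale L(p) ≤ C θ(p)^(−A/2)); scaling theory predicts ν ≍
ξ^(−2) ≍ θ^(2ν/β) with 2ν/β = 2/0.47705 ≈ 4.19 (arXiv:1302.0421), so A ≥ 5 is consistent with the
real world and A ≤ 4 is predicted false; ChayesChayes1986 Thm 4.1(a) (flux ≤ backbone density ≤ p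
θ²) is the proved OPPOSITE comparison and forces A ≥ 2. Implies FluxFromDensity (support
PowerFluxImpliesFlux). [deps: FluxFromDensity] [difficulty: open-problem] (why it might fail: Dies
in the jump world like X, and ALSO if ν(p) decays faster than every power of θ(p) as p↓p_c
(anomalous flux/density scaling); numerics put the exponent at 2ν/β≈4.19, so witnesses need A≥5. No
upper bound θ(p)≤G(anything) for p>p_c is known in 3≤d≤6.) [ChayesChayes1986, arXiv:1302.0421,
Grimmett1999, Zhang2000, BorgsChayesKestenSpencer1999]
#9 PowerFluxImpliesFlux (support) — PowerFluxFromDensity → FluxFromDensity: given A, c, C take s =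
c·t^A (monotonicity of t ↦ t^A on [0,1]). Proved in the planner sketch (Sketch.lean, 5 lines, rc 0).
[difficulty: provable-now] [Grimmett1999]
#9 CutEventContinuous (support) — glue of the Assembly: for all n, k the min-cut event {some F with
≤ k open edges meets every open path of box 3 n from {x₀=−n} to {x₀=n}} has P_p-probability
continuous in p on [0,1]. Proof: the event is determined by the edges with both endpoints in box 3 n
(replace F by its trace on those edges: separation only involves paths inside the box, and the
open-edge count does not increase), then
Literature.Probability.Percolation.continuous_bondPercolation_real_of_determinedBy
(HalfSpaceBGN.lean, proved). [difficulty: provable-now] [Grimmett1999,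
Literature.Probability.Percolation.continuous_bondPercolation_real_of_determinedBy]

TWO-LAYER PLAN. Filed now: FluxFromDensity ⇐ PowerFluxFromDensity (glue PowerFluxImpliesFlux, proved
in sketch). Foreseen glued splits (k ≤ 3, depth 1), nothing
filed until a crux closes: CriticalZeroFlux ⇐ HalfSpaceOneArmVanishes (P_{p_c}(0 ↔ ∂B_ℓ inside ℍ) →
0, from BarskyGrimmettNewman1991_Z3_holds
via ConstrainedClusters) → LevelCutBound (E_p[MC_n] ≤ (2n+1)²·P_p(0 ↔ ∂B_{ℓ−1} in ℍ) for ℓ ≤ 2n: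
deterministic level cut + linearity +
lattice symmetry) → CriticalZeroFlux. PowerFluxFromDensity ⇐ DensityScale (∃ A, C: ∀ p > p_c some
block scale L ≤ C θ(p)^(−A) carries a
Pisztora-type crossing-plus-local-uniqueness event with P_p ≥ 1 − ε₀) → RenormalisedFlux (that event
at scale L ⇒ E_p[MC_n] ≥ c (n/L)² − C n,
p-uniform: Liggett–Schonmann–Stacey domination + Menger on the block lattice, Grimmett1999 §7.4) →
PowerFluxFromDensity. Reserve thesis if X
stalls on '∀ p': the 'infinitely often in p ↓ p_c' version of X, which still suffices once the
subadditive pinned flow τ of RT18 §4 transfers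
lower bounds down the scales.

KILL CRITERIA. CriticalZeroFlux is a theorem and cannot be refuted; if its formalisation balloons (>
3 kLoC) re-file Zhang2000 / RT18 Prop 3.9 as a Literature
cite fact and restate the Assembly with it as hypothesis (route survives). FluxFromDensity refuted ⇔
θ(p_c) > 0 proved — that closes the
sub-problem negatively, not merely the route (close refuted:FluxFromDensity and hand the witness to
every route). PowerFluxFromDensity refuted
for every A (flux super-polynomially small in θ near p_c) kills r4 only: drop it, X stands. θ(p_c) =
0 proved elsewhere moots X but leaves
CriticalZeroFlux as a dossier deliverable. Pivot trigger: a refuter exhibiting a formal reduction X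
⟹ 'GM block scale ≤ F(θ)' (i.e. X is
literally DST uniform control) — then merge with the half-space comparator into one uniform-control
route with a comparator menu (θ_ℍ, ν, φ).

NOT DECOMPOSED YET. The density-only renormalisation under PowerFluxFromDensity (block event, LSS
threshold ε₀, Menger on the block lattice) and the half-space
one-arm lemma + layer-cake bookkeeping under CriticalZeroFlux (both named in the two-layer plan,
filed only after a closure); the π_n-form of X
(P_p(0 ↔ ∂Λ_n) in place of θ(p): card r3 'MengerFromDensity', testable at every single p but with
the same exponent window) and the
isoperimetric twin (anchored isoperimetric profile ≥ g(θ), CerfDembin2020 / Dembin2020) — variants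
of X, deliberately not filed as rival
cruxes; NearCriticalNecking (o(n²) flux uniformly for |p − p_c| < δ — true, needs the pinned
subadditive flow τ); positivity ν(p) > 0 for
p > p_c (Grimmett1999 Thm (7.68), Zhang2000) — used only for the converse direction X ⟸ θ(p_c) = 0,
never by the Assembly; a Literature
definition of the ℕ-valued min-cut / flow constant (requested after open) so that tenure can restate
the items readably.

CHEAPEST FALSIFIER. (a) Lookup, done: is an upper bound on the supercritical density by the flux,
θ(p) ≤ G(ν(p)), or 'ν ≥ g(θ) uniformly' anywhere in print?
`lit citing` Zhang2000 (27 citers, all FPP flow-constant work) and crossref/zbMATH/hybrid searches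
found only the one-sided direction
(CerfDembin2020 Lemma 2.1: isoperimetric profile → 0 as p ↓ p_c) — nothing kills or scoops X. (b)
Numerics a refuter with kit can run in
~1 cpu-day (not run: planners are compute-free on this hub): push–relabel max-flow MC_n on
Bernoulli(p) cubes, n = 16…128, p = 0.2488…0.27,
against θ(p) ≈ P_p(0 ↔ ∂B_256); the slope of log(MC_n/n²) against log θ(p) should settle near 2ν/β ≈
4.19 — a slope drifting upward without
bound as p ↓ p_c kills PowerFluxFromDensity and is the jump-world signature for X. (c) Ten-line
paper check of r2's engine, done by hand:
every open bottom-to-top path of box 3 n first reaches height −n+ℓ through a vertical edge whose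
lower endpoint is joined to the bottom face
inside the slab, so those edges form a cut and E_{p_c}[MC_n] ≤ (2n+1)² P_{p_c}(0 ↔ ∂B_{ℓ−1} in ℍ)
for every ℓ ≤ 2n (RT18 p.17 display).

NUMBERS. p_c(ℤ³, bond) = 0.2488126(5); ν = 0.8764(12), β/ν = 0.47705(15)
(Wang–Zhou–Zhang–Garoni–Deng 2013, arXiv:1302.0421) ⇒ predicted
flux/density exponent 2ν/β = 4.192 (ν(p) ≍ ξ^(−2), θ ≍ ξ^(−β/ν)); proved opposite comparison
ChayesChayes1986 Thm 4.1(a): flux ≤ backbone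
density ≤ p θ(p)², so A ≥ 2 is necessary in PowerFluxFromDensity; Grimmett1999 Thm (7.68) p.180: for
p > p_c, P_p(MC_r ≥ β(p) r²) ≥
1 − exp(−γ(p) r²) with β(p), γ(p) > 0 NON-uniform; deterministic bound MC_n ≤ (2n+1)²; RT18 Prop 3.9
needs only cylinder height h with
h/log(base) → ∞ (cube: fine). Items at open: 6 (3 cruxes, 2 support, 1 assembly).

DEFINITION REQUESTS. None blocking (min-cut event and E_p[MC_n] are written inline over box /
openConnIn / bondPercolation and elaborate, Statements.lean rc 0).
Requested after open, nice-to-have: a Literature notion `minCutBox` / `maxFlowBox` (ℕ-valued: least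
k such that some edge set with ≤ k open
edges meets every open face-to-face path of box 3 n; API: Menger equality with the maximal number of
edge-disjoint open crossings) and
`flowConstant p := lim n⁻² E_p[maxFlowBox n]` (RossignolTheret2018 Thm 2.4) in
Literature/Probability/Percolation, so that tenure can restate
the items readably and the maxflow-budget-ladder card can share them; cite fact wanted only for the
converse direction: Grimmett1999 Thm (7.68)
/ Zhang2000 (ν(p) > 0 for p > p_c).

Novelty: Searches (2026-08-15): `lit search --hybrid "maximal flow critical percolation flow constant zero
cubic lattice"` (12 book rows — Grimmett1999
§13.1 p.379 'open problem', Kesten1982, Grimmett RCM — none joins flux to θ(p_c)); `lit citing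
doi:10.1023/a:1018631726709` (Zhang2000, 27
citers: Rossignol–Théret, Cerf–Théret, Zhang 2018, Garet–Marchand–Procaccia–Théret, Dembin —
CerfDembin2020 arXiv:1903.08065 READ in full);
`lit search --source crossref` "critical behavior for maximal flows on the cubic lattice" / "flow
constant percolation continuity critical
density infinite cluster" and `--source zbmath` "maximal flow critical percolation" (Zhang2000,
RT18, Dembin ECP 2020 arXiv:1901.00367,
Chayes–Chayes PRL 1986); `lit frontier CriticalPhenomena --since 2021` (30 rows, none on flows or
min-cuts); `lit read` arXiv:1707.08766
chunks 5, 16–17 (Thm 2.2–2.4, Prop 3.9 and its BGN step) and Grimmett1999 pp.192–193 (Thm 7.68),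
p.379; the 9 route files and 136 idea cards
of the sub-problem (only maxflow-budget-ladder uses flows — at p_c, a budget ladder, different
cruxes, shares the Zhang base fact);
`ledger negatives` (1 SAW item). OpenAlex and arXiv APIs answered HTTP 429 and `lit galaxy search …
--star all` timed out in the queue (> 90 s)
this session — refuter please re-run `lit galaxy search "maximal flow percolation critical density"
--star all`.
Nearest prior art found: CerfDembin2020 (doi:10.1214/19-ecp281, arXiv:1903.08065) Lemma 2.1 —
Zhang2000 (β_{p_c} = 0) + RossignolTheret2  [refs: 10.1023/a:1018631726709`, 10.1214/19-ecp281, 1903.08065, 1901.00367, 1707.08766, doi:10.1023/a, doi:10.1214/19-ecp281, Grimmett1999, Kesten1982, Zhang2000, CerfDembin2020, RossignolTheret2018, DuminilCopinSidoraviciusTassion2016]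

Barriers (technique_class: flow-constant min-cut uniform-supercritical): - technique_class: flow-constant min-cut uniform-supercritical
- Literature.Barriers.CriticalPhenomena.SlabLimitUniformControl: it does not evade it; the bet is
relocation — X IS a uniform-control statement (comparator ν instead of θ_slab; DST's 'roughly of the
same difficulty' is the honest label), and what is gained is that the controlled quantity is an LP
value (Menger: lower bounds on flux are certified by cut inequalities, and cuts compose by union
across blocks where paths do not) carrying LLN / LDP / continuity theory (Kesten1987, Zhang2000,
RossignolTheret2018) that θ_slab lacks.
- Literature.Barriers.CriticalPhenomena.SprinklingRenormalisation: evaded for CriticalZeroFlux and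
the Assembly (a same-p BGN cutset and a polynomial limit, no sprinkling, no Grimmett–Marstrand);
inside a proof of X at fixed p > p_c sprinkling from (p + p_c)/2 is legal — not evaded is that its
gain must be paid for in θ(p) alone.
- Literature.Barriers.CriticalPhenomena.TransverseCrossingsNeedNotMeet: evaded in form — disjoint
crossings are COUNTED (max-flow) and every lower bound goes through CUTS, which glue by union in any
dimension; no path gluing at or near p_c is attempted.
- Literature.Barriers.CriticalPhenomena.SpanningClustersAboveSix: consistent and not engaged — for d
> 6 the critical cube carries ≍ n^(d−6) spanning clusters yet MC_n = o(n^(d−1)) still (Zhang holds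
in every d), and X / the Assembly are dimension-free in form (θ(p_c) = 0 is true for d ≥ 11 as
well); no d < 6 input is

Novelty grade: variant — ROUTE REVIEW (refuter 2026-08-15). ELAB: all 6 decls rc0. SUPPORT stmt-4888 PROVED in my folder (PowerFluxImpliesFluxProof.lean, s=c·t^A; 0 sorry, std axioms; attached as evidence). STATEMENTS precise: ncard of ↑F∩ω with F a Finset (no junk); MC_n ≤ (2n+1)² (first vertical layer) so the truncated la (refuter refuter-rreview-route-CriticalPhenomena--64a1fcbe-0, 2026-08-15T13:35:24Z; prior: Zhang2000 doi:10.1023/a:1018631726709 (critical flow constant zero), RossignolTheret2018 arXiv:1707.08766 Thm 2.4, Prop 3.9 (BGN cutset step), CerfDembin2020 arXiv:1903.08065 Lemma 2.1 (one-sided: isoperimetric profile → 0 as p↓p_c), DuminilCopinSidoraviciusTassion2016 arXiv:1401.7130 Prop 3 (uniform control) — barrier SlabLimitUniformControl, narrowed by audit, Grimmett1999 Thm (7.68) (β(p)>0 non)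

History (route lifecycle, newest last):
- 2026-08-29T23:50:30Z · DORMANT — reconciler: no traction for 5 d (last activity statement-closed at 2026-08-24T22:59:05Z); parked, not closed — `ledger route dormant route-CriticalPhenomena-Per (operator:999:3232715)

sub-problem: PercolationContinuityZ3 · status: dormant · opened planner-plancard-CriticalPhenomena-Percolatio-42984a14-0 2026-08-15T11:35:31Z · rev 6 · ledger route-CriticalPhenomena-PercFluxFromDensity
GENERATED by the gate from the ledger (D-0016/17). Provers cite these decls: `theorem foo : Summit.CriticalPhenomena.PercolationContinuityZ3.Theses.PercFluxFromDensity.<Decl> := …` in Summits/CriticalPhenomena/PercolationContinuityZ3/Theorems/<Name>.lean.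
-/

namespace Summit.CriticalPhenomena.PercolationContinuityZ3.Theses.PercFluxFromDensity

open scoped BigOperators Topology Manifold Classical MeasureTheory ProbabilityTheory Matrix InnerProductSpace ComplexConjugate ContinuousMap
open Filter Set Function TopologicalSpace MeasureTheory

attribute [summit_statement] _root_.PercolationContinuityZ3

/-- item stmt-CriticalPhenomena-17915 · crux · rank 2 · closed · proved by Summit.CriticalPhenomena.PercolationContinuityZ3.Theorems.PercFluxFromDensityTwoArmFromDensity.twoArmFromDensity_proof @ 3a592c63e608 (prover) · by planner
why it might fail: False iff θ(p_c)>0: zero critical flux (Zhang) + FluxFromGoodBlocks force two-arm events at all large scales as p↓p_c (DKT20 §1.1 Ex.1 'many large clusters avoiding each other'; vdBvE22 Prop 2). In print only pointwise in p (Grimmett Lemma 7.89), never via θ alone.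
sources: Grimmett1999, DuminilcopinKozmaTassion2020, arXiv:1902.03207, Cerf2015, arXiv:1306.3105, VandenbergVanengelenburg2022
[crux] (strategist BC2-redirect of FluxFromDensity stmt-CriticalPhenomena-4886, piece X_A: UNIFORM
LOCAL UNIQUENESS FROM DENSITY) For every density level t > 0 and every ε > 0 there is L₀ such that
for all L ≥ L₀ and EVERY p > p_c(ℤ³) with θ(p) ≥ t: P_p(∃ u, v ∈ Λ_L with u ↔ ∂Λ_{2L}, v ↔ ∂Λ_{2L}
but u ↮ v inside Λ_{2L−1}) ≤ ε — Grimmett's two-arm event A_{2L}(u,v) of (7.91), Lean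
`Literature.Probability.Percolation.twoArm (2 * L) u v`. For each FIXED p > p_c this is Lemma
(7.89); the whole content is uniformity in p through the density θ(p) alone, i.e. excluding 'many
large clusters avoiding each other' near p_c from above (DKT20 §1.1 Example 1). Together with
FluxFromGoodBlocks (X_B) and the PROVED armFromDensity (Λ_L meets C∞ w.h.p. uniformly on the level
set: usc of θ at p_c + Martineau–Tassion uniform percolation + monotone coupling) it yields
FluxFromDensity: theorem fluxFromDensity_of_subs, Cruxes/FluxFromDensity/SplitAssembly.lean (rc0, 0
sorry, axioms standard). S ⇒ X_A by (7.89) with constants monotone from p_t; X_A fails iff θ(p_c) >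
0 (zero critical flux). Birth skeleton `fat-arms-coalesce` (Cruxes/TwoArmFromDensity/Lines/):
TwoArms_L ⊆ (arms are κL³-voluminous)ᶜ ∪ (volu -/
@[route_item "route-CriticalPhenomena-PercFluxFromDensity"]
def TwoArmFromDensity : Prop :=
  ∀ t : ℝ, 0 < t → ∀ ε : ℝ, 0 < ε → ∃ L₀ : ℕ, ∀ L : ℕ, L₀ ≤ L → ∀ p : unitInterval, Literature.Probability.Percolation.criticalProb (Literature.Probability.LatticeModels.zdGraph 3) (0 : Literature.Probability.LatticeModels.Site 3) < (p : ℝ) → t ≤ Literature.Probability.Percolation.theta (Literature.Probability.LatticeModels.zdGraph 3) (0 : Literature.Probability.LatticeModels.Site 3) p → (Literature.Probability.Percolation.bondPercolation (Literature.Probability.LatticeModels.zdGraph 3) p).real {ω | ∃ u ∈ Literature.Probability.LatticeModels.box 3 L, ∃ v ∈ Literature.Probability.LatticeModels.box 3 L, (∃ y ∈ Literature.Probability.LatticeModels.innerBoundary (Literature.Probability.LatticeModels.zdGraph 3) (Literature.Probability.LatticeModels.box 3 (2 * L)), ω ∈ Literature.Probability.Percolation.openConnIn ↑(Literature.Probability.LatticeModels.box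 3 (2 * L)) u y) ∧ (∃ y ∈ Literature.Probability.LatticeModels.innerBoundary (Literature.Probability.LatticeModels.zdGraph 3) (Literature.Probability.LatticeModels.box 3 (2 * L)), ω ∈ Literature.Probability.Percolation.openConnIn ↑(Literature.Probability.LatticeModels.box 3 (2 * L)) v y) ∧ ω ∉ Literature.Probability.Percolation.openConnIn ↑(Literature.Probability.LatticeModels.box 3 (2 * L - 1)) u v} ≤ ε

-- `TwoArmFromDensity` holds: proved by `Summit.CriticalPhenomena.PercolationContinuityZ3.Theorems.PercFluxFromDensityTwoArmFromDensity.twoArmFromDensity_proof` @ 3a592c63e608 (its module imports this route file, so no `_holds` link can be stated here).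

/-- item stmt-CriticalPhenomena-17916 · crux · rank 3 · closed · proved by Summit.CriticalPhenomena.PercolationContinuityZ3.Theorems.FluxGoodBlocks.fluxFromGoodBlocks_proof @ aa264e3ee416 (prover) · by planner
why it might fail: A theorem-schema at every p, in print only for fixed p>p_c and WITH sprinkling (Grimmett Thm 7.68 via (2.46)); risk is uniformity/formal: constants must come from (ε₀,L) only — FKG square-root trick for face links, an 8000-multiplicity cutset count instead of disjointness; L-size.
sources: Grimmett1999, LiggettSchonmannStacey1997, Kesten1987, Zhang2000, RossignolTheret2018, arXiv:1707.08766
[crux] (strategist BC2-redirect of FluxFromDensity stmt-CriticalPhenomena-4886, piece X_B: p-UNIFORM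
STATIC RENORMALISATION ⇒ FLUX) There is an absolute ε₀ > 0 such that for every L ≥ 1 there are c >
0, C with: for EVERY p ∈ [0,1], if (h1) P_p(no vertex of the core Λ_L percolates) ≤ ε₀ and (h2)
P_p(∃ u, v ∈ Λ_{3L+1} joined to ∂Λ_{6L+2} but not to each other inside Λ_{6L+1}) ≤ ε₀, then
E_p[MC_n] ≥ c n² − C n for all n, where E_p[MC_n] is the route's layer-cake sum of the min-cut
probabilities of Λ_n between the faces x₀ = ∓n. Mechanism: Grimmett's proof of Thm (7.68) (p.180)
run at ONE p with the Kesten–Zhang good blocks of §8.6 (renormalised sites x, centres (2L+1)x, cores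
Λ_L: a core arm at radius 8L+3 and no two arms at radius 6L+2 — translates of the complements of
h1/h2's events; good neighbours glue deterministically since both cores' arm vertices have arms at
radius 6L+2 around one centre), face links for the extreme layers by the FKG square-root trick and
lattice symmetry, an 11-dependent block field, planar site duality in each layer of blocks and a
k-dependent Peierls count; CUTSET duality ({not fine} ∪ {blocks near an open edge of F} is a block
cutset) replaces Grimmett's -/
@[route_item "route-CriticalPhenomena-PercFluxFromDensity"]
def FluxFromGoodBlocks : Prop :=
  ∃ ε₀ : ℝ, 0 < ε₀ ∧ ∀ L : ℕ, 1 ≤ L → ∃ c C : ℝ, 0 < c ∧ ∀ p : unitInterval, (Literature.Probability.Percolation.bondPercolation (Literature.Probability.LatticeModels.zdGraph 3) p).real {ω | ∀ w ∈ Literature.Probability.LatticeModels.box 3 L, ω ∉ Literature.Probability.Percolation.percolatesAt w} ≤ ε₀ → (Literature.Probability.Percolation.bondPercolation (Literature.Probability.LatticeModels.zdGraph 3) p).real {ω | ∃ u ∈ Literature.Probability.LatticeModels.box 3 (3 * L + 1), ∃ v ∈ Literature.Probability.LatticeModels.box 3 (3 * L + 1), (∃ y ∈ Literature.Probability.LatticeModels.innerBoundary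 (Literature.Probability.LatticeModels.zdGraph 3) (Literature.Probability.LatticeModels.box 3 (2 * (3 * L + 1))), ω ∈ Literature.Probability.Percolation.openConnIn ↑(Literature.Probability.LatticeModels.box 3 (2 * (3 * L + 1))) u y) ∧ (∃ y ∈ Literature.Probability.LatticeModels.innerBoundary (Literature.Probability.LatticeModels.zdGraph 3) (Literature.Probability.LatticeModels.box 3 (2 * (3 * L + 1))), ω ∈ Literature.Probability.Percolation.openConnIn ↑(Literature.Probability.LatticeModels.box 3 (2 * (3 * L + 1))) v y) ∧ ω ∉ Literature.Probability.Percolation.openConnIn ↑(Literature.Probability.LatticeModels.box 3 (2 * (3 * L + 1) - 1)) u v} ≤ ε₀ → ∀ n : ℕ, c * (n : ℝ) ^ 2 - C * n ≤ ∑ k ∈ Finset.range ((2 * n + 1) ^ 2), (1 - (Literature.Probability.Percolation.bondPercolation (Literature.Probability.LatticeModels.zdGraph 3) p).real {ω | ∃ F : Finset (Sym2 (Literature.Probability.LatticeModels.Site 3)), ((↑F : Set (Sym2 (Literature.Probability.LatticeModels.Site 3))) ∩ ω).ncard ≤ k ∧ ∀ x ∈ Literature.Probability.LatticeModels.box 3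 n, ∀ y ∈ Literature.Probability.LatticeModels.box 3 n, x 0 = -(n : ℤ) → y 0 = (n : ℤ) → ω \ ↑F ∉ Literature.Probability.Percolation.openConnIn ↑(Literature.Probability.LatticeModels.box 3 n) x y})

-- `FluxFromGoodBlocks` holds: proved by `Summit.CriticalPhenomena.PercolationContinuityZ3.Theorems.FluxGoodBlocks.fluxFromGoodBlocks_proof` @ aa264e3ee416 (its module imports this route file, so no `_holds` link can be stated here).

/-- item stmt-CriticalPhenomena-4886 · crux · rank 3 · closed · proved by Summit.CriticalPhenomena.PercolationContinuityZ3.Theorems.PercFluxFromDensityFluxFromDensity.fluxFromDensity_proof @ aa264e3ee416 (prover) · by planner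
why it might fail: False iff θ(p_c(ℤ³))>0: then flux→0 as p↓p_c (Zhang2000 + RT18 continuity = CerfDembin2020 Lem 2.1) while θ(p)≥θ(p_c)=t>0. Nothing in print ties supercritical flux to θ alone: Grimmett1999 Thm (7.68) has β(p)>0 via Grimmett–Marstrand, non-uniform; DST16 Prop 3 rates uniform control same difficulty.
sources: CerfDembin2020, arXiv:1903.08065, Grimmett1999, DuminilCopinSidoraviciusTassion2016, arXiv:1401.7130, Zhang2000
[crux] X itself (card r2, qualitative form): ∀ t > 0 ∃ s > 0, C: ∀ p > p_c(ℤ³) with θ(p) ≥ t, ∀ n: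
E_p[MC_n] ≥ s n² − C n, with E_p[MC_n] the layer-cake sum of min-cut probabilities of box 3 n
between the faces x₀ = ∓n. EQUIVALENT to θ(p_c) = 0 given CriticalZeroFlux, Grimmett1999 Thm (7.68)
and right-continuity of θ; its whole content is that the supercritical flux is bounded below by a
function of the DENSITY ALONE, uniformly as p ↓ p_c. [deps: CriticalZeroFlux] [difficulty:
open-problem] -/
@[route_item "route-CriticalPhenomena-PercFluxFromDensity"]
def FluxFromDensity : Prop :=
  ∀ t : ℝ, 0 < t → ∃ s C : ℝ, 0 < s ∧ ∀ p : unitInterval, Literature.Probability.Percolation.criticalProb (Literature.Probability.LatticeModels.zdGraph 3) (0 : Literature.Probability.LatticeModels.Site 3) < (p : ℝ) → t ≤ Literature.Probability.Percolation.theta (Literature.Probability.LatticeModels.zdGraph 3) (0 : Literature.Probability.LatticeModels.Site 3) p → ∀ n : ℕ, s * (n : ℝ) ^ 2 - C * n ≤ ∑ k ∈ Finset.range ((2 * n + 1) ^ 2), (1 - (Literature.Probability.Percolation.bondPercolation (Literature.Probability.LatticeModels.zdGraph 3) p).real {ω | ∃ F : Finset (Sym2 (Literature.Probability.LatticeModels.Site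 3)), ((↑F : Set (Sym2 (Literature.Probability.LatticeModels.Site 3))) ∩ ω).ncard ≤ k ∧ ∀ x ∈ Literature.Probability.LatticeModels.box 3 n, ∀ y ∈ Literature.Probability.LatticeModels.box 3 n, x 0 = -(n : ℤ) → y 0 = (n : ℤ) → ω \ ↑F ∉ Literature.Probability.Percolation.openConnIn ↑(Literature.Probability.LatticeModels.box 3 n) x y})

-- `FluxFromDensity` holds: proved by `Summit.CriticalPhenomena.PercolationContinuityZ3.Theorems.PercFluxFromDensityFluxFromDensity.fluxFromDensity_proof` @ aa264e3ee416 (its module imports this route file, so no `_holds` link can be stated here).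

/-- item stmt-CriticalPhenomena-4885 · support · rank 2 · closed · proved by Summit.CriticalPhenomena.PercolationContinuityZ3.Theorems.PercFluxFromDensityCriticalZeroFlux.criticalZeroFlux_proof @ 39863631be92 (prover) · by planner
why it might fail: A theorem on paper (RT18 Prop 3.9 via Grimmett Thm 7.35); the risk is formal: BGN_Z3 speaks of θ of the INDUCED half-space graph, the cut needs openConnIn-restricted paths of the full configuration (bridge: ConstrainedClusters.lean) plus a layer-cake identity — L-size, not S.
sources: Zhang2000, RossignolTheret2018, arXiv:1707.08766, Grimmett1999, BarskyGrimmettNewman1991, Literature.Probability.Percolation.BarskyGrimmettNewman1991_Z3_holds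
[crux] Zhang's zero critical flux in finite volume (Zhang2000; RossignolTheret2018 Prop 3.9,
Bernoulli capacities, cube): at p = p_c(ℤ³), for every ε > 0 and all large n, Σ_{k<(2n+1)²} (1 −
P_{p_c}(some edge set F with ≤ k open edges meets every open path of box 3 n from {x₀ = −n} to {x₀ =
n})) ≤ ε n², i.e. E_{p_c}[MC_n] = o(n²). Proof to formalise (RT18 p.17): the level-ℓ cut F_ℓ =
vertical edges from height −n+ℓ−1 to −n+ℓ whose lower endpoint is joined to the bottom face by an
open path inside the slab is a separating set for every configuration, so MC_n ≤ |F_ℓ| and E|F_ℓ| ≤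
(2n+1)² · P_{p_c}(0 ↔ ∂B(ℓ−1) inside the half-space) → 0 as ℓ → ∞ by
BarskyGrimmettNewman1991_Z3_holds (PROVED in tree, HalfSpaceProofs.lean) and continuity from above.
Ranked FIRST by the plancard rule (the one unproved published fact the Assembly needs); it is also
the dossier fact 'the counterfactual critical cluster carries zero flux' wanted by cards
two-arm-foam-structure, sponge-fkg-fragile-giant, critical-cluster-threshold-one and the base rung
L0 of maxflow-budget-ladder. [difficulty: L] -/
@[route_item "route-CriticalPhenomena-PercFluxFromDensity"]
def CriticalZeroFlux : Prop :=
  ∀ ε : ℝ, 0 < ε → ∃ n₀ : ℕ, ∀ n : ℕ, n₀ ≤ n → ∑ k ∈ Finset.range ((2 * n + 1) ^ 2), (1 - (Literature.Probability.Percolation.bondPercolation (Literature.Probability.LatticeModels.zdGraph 3) (Literature.Probability.Percolation.criticalProbI 3)).real {ω | ∃ F : Finset (Sym2 (Literature.Probability.LatticeModels.Site 3)), ((↑F : Set (Sym2 (Literature.Probability.LatticeModels.Site 3))) ∩ ω).ncard ≤ k ∧ ∀ x ∈ Literature.Probability.LatticeModels.box 3 n, ∀ y ∈ Literature.Probability.LatticeModels.box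 3 n, x 0 = -(n : ℤ) → y 0 = (n : ℤ) → ω \ ↑F ∉ Literature.Probability.Percolation.openConnIn ↑(Literature.Probability.LatticeModels.box 3 n) x y}) ≤ ε * (n : ℝ) ^ 2

-- `CriticalZeroFlux` holds: proved by `Summit.CriticalPhenomena.PercolationContinuityZ3.Theorems.PercFluxFromDensityCriticalZeroFlux.criticalZeroFlux_proof` @ 39863631be92 (its module imports this route file, so no `_holds` link can be stated here).

/-- item stmt-CriticalPhenomena-4887 · aside · rank 4 · open · by planner
why it might fail: False if θ(p_c)>0 (as FluxFromDensity) and ALSO if ν(p)→0 faster than every power of θ(p) as p↓p_c; scaling predicts ν≍ξ⁻²≍θ^(2ν/β), 2ν/β=2/0.47705≈4.19 (arXiv:1302.0421), so only A≥5 can witness; the one proved comparison is opposite, flux ≤ p·θ² (BK, Grimmett1999 Thm (2.12); ChayesChayes1986).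
sources: arXiv:1302.0421, ChayesChayes1986, Grimmett1999, BorgsChayesKestenSpencer1999, Zhang2000
[crux] power-law form of X (card 'g(t) = c t^A'): ∃ A ∈ ℕ, c > 0, C: ∀ p > p_c(ℤ³), ∀ n: E_p[MC_n] ≥
c n² θ(p)^A − C n. This is the shape a density-only renormalisation would deliver (ν(p) ≥ c/L(p)²
from a good block scale L(p) ≤ C θ(p)^(−A/2)); scaling theory predicts ν ≍ ξ^(−2) ≍ θ^(2ν/β) with
2ν/β = 2/0.47705 ≈ 4.19 (arXiv:1302.0421), so A ≥ 5 is consistent with the real world and A ≤ 4 is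
predicted false; ChayesChayes1986 Thm 4.1(a) (flux ≤ backbone density ≤ p θ²) is the proved OPPOSITE
comparison and forces A ≥ 2. Implies FluxFromDensity (support PowerFluxImpliesFlux). [deps:
FluxFromDensity] [difficulty: open-problem] -/
@[route_item "route-CriticalPhenomena-PercFluxFromDensity"]
def PowerFluxFromDensity : Prop :=
  ∃ (A : ℕ) (c C : ℝ), 0 < c ∧ ∀ p : unitInterval, Literature.Probability.Percolation.criticalProb (Literature.Probability.LatticeModels.zdGraph 3) (0 : Literature.Probability.LatticeModels.Site 3) < (p : ℝ) → ∀ n : ℕ, c * (n : ℝ) ^ 2 * (Literature.Probability.Percolation.theta (Literature.Probability.LatticeModels.zdGraph 3) (0 : Literature.Probability.LatticeModels.Site 3) p) ^ A - C * n ≤ ∑ k ∈ Finset.range ((2 * n + 1) ^ 2), (1 - (Literature.Probability.Percolation.bondPercolation (Literature.Probability.LatticeModels.zdGraph 3) p).real {ω | ∃ F : Finset (Sym2 (Literature.Probability.LatticeModels.Site 3)), ((↑F : Set (Sym2 (Literature.Probability.LatticeModels.Site 3))) ∩ ω).ncard ≤ k ∧ ∀ x ∈ Literature.Probability.LatticeModels.box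 3 n, ∀ y ∈ Literature.Probability.LatticeModels.box 3 n, x 0 = -(n : ℤ) → y 0 = (n : ℤ) → ω \ ↑F ∉ Literature.Probability.Percolation.openConnIn ↑(Literature.Probability.LatticeModels.box 3 n) x y})

/-- item stmt-CriticalPhenomena-17920 · support · rank 9 · closed · proved by Summit.CriticalPhenomena.PercolationContinuityZ3.Theorems.PercFluxFromDensityFluxFromDensitySplit.fluxFromDensitySplitGlue_proof @ 37ca0203f76f (prover) · by planner
[support] (strategist split glue) TwoArmFromDensity → FluxFromGoodBlocks → FluxFromDensity. PROVED
sorry-free: theorem fluxFromDensity_of_subs in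
Summits/CriticalPhenomena/PercolationContinuityZ3/Cruxes/FluxFromDensity/SplitAssembly.lean (lean
check rc0, 0 sorry, axioms {propext, Classical.choice, Quot.sound}; evidence on
stmt-CriticalPhenomena-4886). The seam is not modus ponens: it proves the third Kesten–Zhang
hypothesis armFromDensity — for t, ε > 0 there is L₀ with P_p(no vertex of Λ_L percolates) ≤ ε for
all L ≥ L₀ and all p > p_c with θ(p) ≥ t (right upper semicontinuity of θ at p_c via θ ≤ θ_n =
P(0↔∂Λ_n) polynomial in p (Grimmett Lemma 8.9), a base point a below the level set with θ(a) > 0,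
Martineau–Tassion uniform percolation from large sets at a
(exists_card_le_imp_lt_real_exists_percolatesAt), monotone coupling
(DCT16.real_mono_of_isUpperSet)); then X_A at scale 3L+1 and X_B at L = max(L₁, L₂, 1) give s =
c(L), C = C(L). A prover lands SplitAssembly.lean verbatim as
Theorems/PercFluxFromDensityFluxFromDensitySplit.lean (its local hypothesis defs are defeq by delta
to the route decls TwoArmFromDensity / FluxFromGoodBlocks) and closes this item with `theorem
fluxFromDens -/
@[route_item "route-CriticalPhenomena-PercFluxFromDensity"]
def FluxFromDensitySplitGlue : Prop :=
  TwoArmFromDensity → FluxFromGoodBlocks → FluxFromDensity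

-- `FluxFromDensitySplitGlue` holds: proved by `Summit.CriticalPhenomena.PercolationContinuityZ3.Theorems.PercFluxFromDensityFluxFromDensitySplit.fluxFromDensitySplitGlue_proof` @ 37ca0203f76f (its module imports this route file, so no `_holds` link can be stated here).

/-- item stmt-CriticalPhenomena-4888 · support · rank 9 · closed · proved by Summit.CriticalPhenomena.PercolationContinuityZ3.Theorems.PercFluxFromDensityPowerFluxImpliesFlux.powerFluxImpliesFlux_proof @ 37ca0203f76f (prover) · by planner
sources: Grimmett1999
[support] PowerFluxFromDensity → FluxFromDensity: given A, c, C take s = c·t^A (monotonicity of t ↦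
t^A on [0,1]). Proved in the planner sketch (Sketch.lean, 5 lines, rc 0). [difficulty: provable-now] -/
@[route_item "route-CriticalPhenomena-PercFluxFromDensity"]
def PowerFluxImpliesFlux : Prop :=
  PowerFluxFromDensity → FluxFromDensity

-- `PowerFluxImpliesFlux` holds: proved by `Summit.CriticalPhenomena.PercolationContinuityZ3.Theorems.PercFluxFromDensityPowerFluxImpliesFlux.powerFluxImpliesFlux_proof` @ 37ca0203f76f (its module imports this route file, so no `_holds` link can be stated here).

/-- item stmt-CriticalPhenomena-4889 · support · rank 9 · closed · proved by Summit.CriticalPhenomena.PercolationContinuityZ3.Theorems.PercFluxFromDensityCutEventContinuous.cutEventContinuous_proof @ e90acde18099 (prover) · by planner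
sources: Grimmett1999, Literature.Probability.Percolation.continuous_bondPercolation_real_of_determinedBy
[support] glue of the Assembly: for all n, k the min-cut event {some F with ≤ k open edges meets
every open path of box 3 n from {x₀=−n} to {x₀=n}} has P_p-probability continuous in p on [0,1].
Proof: the event is determined by the edges with both endpoints in box 3 n (replace F by its trace
on those edges: separation only involves paths inside the box, and the open-edge count does not
increase), then Literature.Probability.Percolation.continuous_bondPercolation_real_of_determinedBy
(HalfSpaceBGN.lean, proved). [difficulty: provable-now] -/
@[route_item "route-CriticalPhenomena-PercFluxFromDensity"]
def CutEventContinuous : Prop :=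
  ∀ n k : ℕ, Continuous fun p : unitInterval => (Literature.Probability.Percolation.bondPercolation (Literature.Probability.LatticeModels.zdGraph 3) p).real {ω | ∃ F : Finset (Sym2 (Literature.Probability.LatticeModels.Site 3)), ((↑F : Set (Sym2 (Literature.Probability.LatticeModels.Site 3))) ∩ ω).ncard ≤ k ∧ ∀ x ∈ Literature.Probability.LatticeModels.box 3 n, ∀ y ∈ Literature.Probability.LatticeModels.box 3 n, x 0 = -(n : ℤ) → y 0 = (n : ℤ) → ω \ ↑F ∉ Literature.Probability.Percolation.openConnIn ↑(Literature.Probability.LatticeModels.box 3 n) x y}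

-- `CutEventContinuous` holds: proved by `Summit.CriticalPhenomena.PercolationContinuityZ3.Theorems.PercFluxFromDensityCutEventContinuous.cutEventContinuous_proof` @ e90acde18099 (its module imports this route file, so no `_holds` link can be stated here).

/-- item stmt-CriticalPhenomena-4890 · assembly · rank 1 · closed · proved by Summit.CriticalPhenomena.PercolationContinuityZ3.Theorems.PercFluxFromDensityAssembly.assembly_proof @ 7974026f4dee (prover) · by planner
sources: Zhang2000, Grimmett1999
[assembly] CriticalZeroFlux → FluxFromDensity → PercolationContinuityZ3 (θ monotone + continuity of
the finite-volume flux in p + p_c < 1). -/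
@[route_item "route-CriticalPhenomena-PercFluxFromDensity"]
def Assembly : Prop :=
  CriticalZeroFlux → FluxFromDensity → PercolationContinuityZ3

-- `Assembly` holds: proved by `Summit.CriticalPhenomena.PercolationContinuityZ3.Theorems.PercFluxFromDensityAssembly.assembly_proof` @ 7974026f4dee (its module imports this route file, so no `_holds` link can be stated here).

/-! D-0027 §2.1 — DECIDING THEOREM (planner-authored via `route open/edit --closes-file`; by planner-cstrat-stmt-CriticalPhenomena-4886-r1-0 2026-08-17T05:07:34Z):
its hypotheses are this route's items and its conclusion the sub-problem Statement (glue_lint), and it elaborates with this file. -/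

@[closes "route-CriticalPhenomena-PercFluxFromDensity"] theorem closes (h_CriticalZeroFlux : CriticalZeroFlux) (h_TwoArmFromDensity : TwoArmFromDensity)
    (h_FluxFromGoodBlocks : FluxFromGoodBlocks) (h_FluxFromDensitySplitGlue : FluxFromDensitySplitGlue)
    (h_Assembly : Assembly) : _root_.PercolationContinuityZ3 :=
  h_Assembly h_CriticalZeroFlux (h_FluxFromDensitySplitGlue h_TwoArmFromDensity h_FluxFromGoodBlocks)

end Summit.CriticalPhenomena.PercolationContinuityZ3.Theses.PercFluxFromDensity
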